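import Mathlib.Algebra.MvPolynomial.PDeriv
import Mathlib.Algebra.MvPolynomial.Equiv
import Mathlib.RingTheory.MvPolynomial.Homogeneous
import Mathlib.Algebra.MvPolynomial.Monad
import HarnessLib

/-!
# The DESCENT SPACE `W(Φ)` of a form (W4.1, F-B card 7): definitions, and L2a/L2a′ — `W(Φ)` is a linear subspace

W4.1, crux `Steer` (stmt-ResolutionOfSingularities-16345), frontier piece F-B (`StrippingTailHighConclTwoN`): the
POLYNOMIAL CORES of res-L0-w41-idea-1 g7's card 7 `kangaroo-free-parity-automaton` (`Sketch-idea-1-v9-fb.lean`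
1cd28c90a6f7445c; res-L0-w41-plan-1 RULINGS 81b / 84d; tri-1 TRIAGE v6.8 first read). This file carries the five
definitions of the sketch, VERBATIM up to the generalisation `Fin 4 ↦ σ` (any finite index type; idea-1 g8 «citable: yes»
10:36:08Z), so that the six stubs of the sketch are stated literally, and PROVES the first two of them (L2a/L2a′: the
descent space is closed under `+` and scalars, with no hypothesis on the characteristic); the remaining stubs are proved in
the sibling files `FrobeniusClosingSteerDescentSpace*.lean` importing this one (seat res-D-pv-007 AS res-L0-w41-stub-5):

* `genTransl κ c` — translation of `𝔸^σ_κ` by the GENERIC multiple `t • c` of a vector `c` (`t` the polynomial variable):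
  `X i ↦ X i + (c i · t)`; `IsLineInvariant κ c P` — invariance of `P` under it (= under the line `κ̄ · c`, robust for
  finite `κ`);
* `descentSpace κ Φ` — the vectors `c` along which the exact 1-form `dΦ` descends: `∂_c Φ = 0` and every partial
  `∂_j Φ` is invariant along `κ̄·c` (idea-1: the replacement of the directrix for the cleaned quadratic sequence at `p = 2`);
* `dehomTransl κ j c` — dehomogenisation at the point `c` of the chart `{X_j ≠ 0}`: `X_j ↦ 1`, `X_i ↦ X_i + c_i`;
* `SubTopIsSquare κ n P` — «`P ≡ q²` modulo monomials of degree `≥ n`»;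
* §1 line invariance is a `κ`-linear, multiplicative condition (`IsLineInvariant.add/.sub/.mul/.smul/.sum`, constants);
* §2 `descentSpace_add` (L2a), `descentSpace_smul` (L2a′), `zero_mem_descentSpace` — via the two-step translation
  `aeval_genTransl` (translate by `t•c`, then by `t•c'` = by `t•(c+c')`) and the rescaling `t ↦ a·t` (`map_genTransl_smul`).

OURS (research support for an idea card; candidates, not facts); nothing here is a statement of the manuscript under
review [claim: Hironaka2017, status: under-review]; AI work, weaker than expert review. No instances, no notation.
[cite: CossartPiltant2009, p. 9 (directrix of cl_ε J(f,E,x))] [folklore]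
-/

noncomputable section

-- `Summit.<S>.<S>.…` duplicates the summit name by design (single-problem summit).
set_option linter.dupNamespace false

open MvPolynomial

namespace Summit.ResolutionOfSingularities.ResolutionOfSingularities.Theorems.SwitchingDichotomy.DescentSpace

universe u v

section Defs

variable (κ : Type u) [Field κ] {σ : Type v}

/-- Translation of `𝔸^σ_κ` by the GENERIC multiple `t • c` of a vector `c` (`t` = the polynomial variable):
`X i ↦ X i + (c i · t)`. Invariance under it is invariance under the line `κ̄ · c` (robust also for finite `κ`).
(res-L0-w41-idea-1 card 7, verbatim with `Fin 4 ↦ σ`.) OURS. [folklore] -/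
def genTransl (c : σ → κ) : MvPolynomial σ κ →ₐ[κ] MvPolynomial σ (Polynomial κ) :=
  aeval fun i => X i + C (Polynomial.C (c i) * Polynomial.X)

/-- `P` is invariant under all translations along the line spanned by `c`: `P(X + t·c) = P(X)` identically in the
generic parameter `t`. (res-L0-w41-idea-1 card 7, verbatim.) OURS. [folklore] -/
def IsLineInvariant (c : σ → κ) (P : MvPolynomial σ κ) : Prop :=
  genTransl κ c P = map (algebraMap κ (Polynomial κ)) P

/-- DESCENT SPACE `W(Φ)` of a form `Φ` (canonical in `Φ mod squares`, since it only sees `dΦ`): the vectors `c` along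
which the exact 1-form `dΦ` descends to `𝔸/⟨c⟩` — the directional derivative `∂_c Φ` vanishes and every partial `∂_j Φ`
is invariant along the line `κ̄·c`. At `p = 2` over a perfect field this is idea-1's replacement of the directrix for the
cleaned quadratic sequence (`descent_iff_sq_adapted` in the sibling file); it is a linear subspace with no characteristic
hypothesis (`descentSpace_add`, `descentSpace_smul`). (res-L0-w41-idea-1 card 7, verbatim with `Fin 4 ↦ σ`.) OURS.
[cite: CossartPiltant2009, p. 9] [folklore] -/
def descentSpace [Fintype σ] (Φ : MvPolynomial σ κ) : Set (σ → κ) :=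
  {c | (∑ i, c i • pderiv i Φ) = 0 ∧ ∀ j, IsLineInvariant κ c (pderiv j Φ)}

/-- Dehomogenisation of a form at the point `c` of the chart `U_j = {X_j ≠ 0}` of `ℙ(𝔸^σ)` (`c j = 1` understood):
`X_j ↦ 1`, `X_i ↦ X_i + c_i` (`i ≠ j`) — `Φ(1, y + c)`, the restriction to the exceptional divisor of the transform of a
point round in the chart `x_j`. (res-L0-w41-idea-1 card 7, verbatim with `Fin 4 ↦ σ`.) OURS. [folklore] -/
def dehomTransl [DecidableEq σ] (j : σ) (c : σ → κ) : MvPolynomial σ κ →ₐ[κ] MvPolynomial σ κ :=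
  aeval fun i => if i = j then 1 else X i + C (c i)

/-- «The part of `P` of degree `< n` is a square»: `P ≡ q²` modulo monomials of total degree `≥ n`.
(res-L0-w41-idea-1 card 7, verbatim with `Fin 4 ↦ σ`.) OURS. [folklore] -/
def SubTopIsSquare (n : ℕ) (P : MvPolynomial σ κ) : Prop :=
  ∃ q : MvPolynomial σ κ, ∀ m ∈ (P - q ^ 2).support, n ≤ m.sum fun _ e => e

end Defs

/-! ## §1 Line invariance is a linear condition; constants are invariant -/

section Linear

variable {κ : Type u} [Field κ] {σ : Type v}

/-- Unfolding of `genTransl` on a variable. [folklore] -/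
theorem genTransl_X (c : σ → κ) (i : σ) :
    genTransl κ c (X i) = X i + C (Polynomial.C (c i) * Polynomial.X) := by
  simp [genTransl]

/-- Unfolding of `genTransl` on a constant. [folklore] -/
theorem genTransl_C (c : σ → κ) (a : κ) :
    genTransl κ c (C a) = C (Polynomial.C a) := by
  simp [genTransl, IsScalarTower.algebraMap_apply κ (Polynomial κ) (MvPolynomial σ (Polynomial κ)),
    MvPolynomial.algebraMap_eq, Polynomial.algebraMap_eq]

/-- Constants are line-invariant. [folklore] -/
theorem isLineInvariant_C (c : σ → κ) (a : κ) : IsLineInvariant κ c (C a) := by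
  unfold IsLineInvariant
  rw [genTransl_C, map_C, Polynomial.algebraMap_eq]

/-- `0` is line-invariant. [folklore] -/
theorem isLineInvariant_zero (c : σ → κ) : IsLineInvariant κ c 0 := by
  unfold IsLineInvariant; simp

/-- Sums of line-invariant polynomials are line-invariant. [folklore] -/
theorem IsLineInvariant.add {c : σ → κ} {P Q : MvPolynomial σ κ} (hP : IsLineInvariant κ c P)
    (hQ : IsLineInvariant κ c Q) : IsLineInvariant κ c (P + Q) := by
  unfold IsLineInvariant at *
  rw [map_add, map_add, hP, hQ]

/-- Differences of line-invariant polynomials are line-invariant. [folklore] -/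
theorem IsLineInvariant.sub {c : σ → κ} {P Q : MvPolynomial σ κ} (hP : IsLineInvariant κ c P)
    (hQ : IsLineInvariant κ c Q) : IsLineInvariant κ c (P - Q) := by
  unfold IsLineInvariant at *
  rw [map_sub, map_sub, hP, hQ]

/-- Products of line-invariant polynomials are line-invariant. [folklore] -/
theorem IsLineInvariant.mul {c : σ → κ} {P Q : MvPolynomial σ κ} (hP : IsLineInvariant κ c P)
    (hQ : IsLineInvariant κ c Q) : IsLineInvariant κ c (P * Q) := by
  unfold IsLineInvariant at *
  rw [map_mul, map_mul, hP, hQ]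

/-- Scalar multiples of line-invariant polynomials are line-invariant. [folklore] -/
theorem IsLineInvariant.smul {c : σ → κ} {P : MvPolynomial σ κ} (a : κ) (hP : IsLineInvariant κ c P) :
    IsLineInvariant κ c (a • P) := by
  rw [smul_eq_C_mul]
  exact (isLineInvariant_C c a).mul hP

/-- Finite sums of line-invariant polynomials are line-invariant. [folklore] -/
theorem IsLineInvariant.sum {c : σ → κ} {ι : Type*} (s : Finset ι) {P : ι → MvPolynomial σ κ}
    (hP : ∀ i ∈ s, IsLineInvariant κ c (P i)) : IsLineInvariant κ c (∑ i ∈ s, P i) := by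
  classical
  induction s using Finset.induction_on with
  | empty => simpa using isLineInvariant_zero c
  | insert a s ha ih =>
    rw [Finset.sum_insert ha]
    exact (hP a (Finset.mem_insert_self a s)).add (ih fun i hi => hP i (Finset.mem_insert_of_mem hi))

/-! ## §2 L2a / L2a′: the descent space is a linear subspace (no characteristic hypothesis) -/

/-- Translating by `t • c` and then by `t • c'` is translating by `t • (c + c')`. [folklore] -/
theorem aeval_genTransl (c c' : σ → κ) (P : MvPolynomial σ κ) :
    aeval (fun i => (X i : MvPolynomial σ (Polynomial κ)) + C (Polynomial.C (c' i) * Polynomial.X))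
        (genTransl κ c P) = genTransl κ (c + c') P := by
  induction P using MvPolynomial.induction_on with
  | C a => rw [genTransl_C, genTransl_C, aeval_C, MvPolynomial.algebraMap_eq]
  | add p q hp hq => rw [map_add, map_add, hp, hq, map_add]
  | mul_X p i hp =>
    rw [map_mul, map_mul, hp, map_mul, genTransl_X, genTransl_X, map_add, aeval_X, aeval_C,
      MvPolynomial.algebraMap_eq, Pi.add_apply, Polynomial.C_add, add_mul, map_add]
    ring

/-- Translating the constant extension of `P` by `t • c'` is `genTransl c' P`. [folklore] -/
theorem aeval_map_algebraMap (c' : σ → κ) (P : MvPolynomial σ κ) :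
    aeval (fun i => (X i : MvPolynomial σ (Polynomial κ)) + C (Polynomial.C (c' i) * Polynomial.X))
        (map (algebraMap κ (Polynomial κ)) P) = genTransl κ c' P := by
  induction P using MvPolynomial.induction_on with
  | C a => rw [map_C, genTransl_C, aeval_C, MvPolynomial.algebraMap_eq, Polynomial.algebraMap_eq]
  | add p q hp hq => rw [map_add, map_add, hp, hq, map_add]
  | mul_X p i hp => rw [map_mul, map_mul, hp, map_mul, map_X, aeval_X, genTransl_X]

/-- **Invariance under two lines gives invariance under their sum.** [folklore] -/
theorem IsLineInvariant.add_dir {c c' : σ → κ} {P : MvPolynomial σ κ} (hc : IsLineInvariant κ c P)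
    (hc' : IsLineInvariant κ c' P) : IsLineInvariant κ (c + c') P := by
  unfold IsLineInvariant at *
  rw [← aeval_genTransl c c' P, hc, aeval_map_algebraMap, hc']

/-- Rescaling the generic parameter `t ↦ a·t` turns translation by `t • c` into translation by `t • (a • c)`.
[folklore] -/
theorem map_genTransl_smul (c : σ → κ) (a : κ) (P : MvPolynomial σ κ) :
    map (Polynomial.aeval (Polynomial.C a * Polynomial.X) : Polynomial κ →ₐ[κ] Polynomial κ).toRingHom
        (genTransl κ c P) = genTransl κ (a • c) P := by
  induction P using MvPolynomial.induction_on with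
  | C b =>
    rw [genTransl_C, genTransl_C, map_C]
    congr 1
    change Polynomial.aeval (Polynomial.C a * Polynomial.X) (Polynomial.C b) = Polynomial.C b
    rw [Polynomial.aeval_C, Polynomial.algebraMap_eq]
  | add p q hp hq => rw [map_add, map_add, hp, hq, map_add]
  | mul_X p i hp =>
    have hτ : (Polynomial.aeval (Polynomial.C a * Polynomial.X) : Polynomial κ →ₐ[κ] Polynomial κ).toRingHom
        (Polynomial.C (c i) * Polynomial.X) = Polynomial.C ((a • c) i) * Polynomial.X := by
      change Polynomial.aeval (Polynomial.C a * Polynomial.X) (Polynomial.C (c i) * Polynomial.X) = _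
      rw [map_mul, Polynomial.aeval_C, Polynomial.aeval_X, Polynomial.algebraMap_eq, Pi.smul_apply,
        smul_eq_mul, ← mul_assoc, ← Polynomial.C_mul, mul_comm (c i) a]
    rw [map_mul, map_mul, hp, map_mul, genTransl_X, genTransl_X, map_add, map_X, map_C, hτ]

/-- The rescaling `t ↦ a·t` fixes constant extensions. [folklore] -/
theorem map_aevalScale_map (a : κ) (P : MvPolynomial σ κ) :
    map (Polynomial.aeval (Polynomial.C a * Polynomial.X) : Polynomial κ →ₐ[κ] Polynomial κ).toRingHom
        (map (algebraMap κ (Polynomial κ)) P) = map (algebraMap κ (Polynomial κ)) P := by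
  have hfg : (Polynomial.aeval (Polynomial.C a * Polynomial.X) : Polynomial κ →ₐ[κ] Polynomial κ).toRingHom.comp
      (algebraMap κ (Polynomial κ)) = algebraMap κ (Polynomial κ) :=
    RingHom.ext fun b => (Polynomial.aeval (Polynomial.C a * Polynomial.X)).commutes b
  rw [map_map, hfg]

/-- **Invariance under a line gives invariance under its scalar multiples.** [folklore] -/
theorem IsLineInvariant.smul_dir {c : σ → κ} {P : MvPolynomial σ κ} (a : κ) (hc : IsLineInvariant κ c P) :
    IsLineInvariant κ (a • c) P := by
  unfold IsLineInvariant at *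
  rw [← map_genTransl_smul c a P, hc, map_aevalScale_map]

variable [Fintype σ]

/-- **L2a — the descent space is closed under addition** (res-L0-w41-idea-1 card 7, `stub_descentSpace_add`, PROVED;
no characteristic hypothesis). [folklore] -/
theorem descentSpace_add (Φ : MvPolynomial σ κ) {c c' : σ → κ}
    (hc : c ∈ descentSpace κ Φ) (hc' : c' ∈ descentSpace κ Φ) : c + c' ∈ descentSpace κ Φ := by
  obtain ⟨h1, h2⟩ := hc
  obtain ⟨h1', h2'⟩ := hc'
  refine ⟨?_, fun j => (h2 j).add_dir (h2' j)⟩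
  simp only [Pi.add_apply, add_smul, Finset.sum_add_distrib, h1, h1', add_zero]

/-- **L2a′ — the descent space is closed under scalars** (res-L0-w41-idea-1 card 7, `stub_descentSpace_smul`, PROVED).
[folklore] -/
theorem descentSpace_smul (Φ : MvPolynomial σ κ) {c : σ → κ} (a : κ)
    (hc : c ∈ descentSpace κ Φ) : a • c ∈ descentSpace κ Φ := by
  obtain ⟨h1, h2⟩ := hc
  refine ⟨?_, fun j => (h2 j).smul_dir a⟩
  simp only [Pi.smul_apply, smul_eq_mul, mul_smul, ← Finset.smul_sum, h1, smul_zero]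

/-- `0` lies in every descent space. [folklore] -/
theorem zero_mem_descentSpace (Φ : MvPolynomial σ κ) : (0 : σ → κ) ∈ descentSpace κ Φ := by
  refine ⟨by simp, fun j => ?_⟩
  unfold IsLineInvariant genTransl
  have : (fun i : σ => (X i : MvPolynomial σ (Polynomial κ)) + C (Polynomial.C ((0 : σ → κ) i) * Polynomial.X)) =
      fun i => X i := by
    funext i; simp
  rw [this]
  induction (pderiv j Φ) using MvPolynomial.induction_on with
  | C a =>
    rw [aeval_C, map_C, IsScalarTower.algebraMap_apply κ (Polynomial κ) (MvPolynomial σ (Polynomial κ)),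
      MvPolynomial.algebraMap_eq]
  | add p q hp hq => rw [map_add, map_add, hp, hq]
  | mul_X p i hp => rw [map_mul, map_mul, hp, aeval_X, map_X]

end Linear

end Summit.ResolutionOfSingularities.ResolutionOfSingularities.Theorems.SwitchingDichotomy.DescentSpace

end
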